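import Summits.BirchSwinnertonDyer.Rank1Residual.F1Sign2.TamagawaExponentAtTwo
import Literature.NumberTheory.EllipticCurves.GlobalMinimalModel
import HarnessLib

/-!
# ES-35 (-es g26) — THE ARCHIMEDEAN COMPONENT GROUP IN THE 2-ADIC FLOOR OF THE MODULAR DEGREE
# (sketch; crux `RankOneAtTwoBigImageOddLocal` = stmt-BirchSwinnertonDyer-23715; cell bsd-f1-sign2, search question «what is the signed / ± object at 2?»)

ANSWER PROPOSED BY THIS LENS PASS: the signed object is `c_∞(E) := #π₀(E(ℝ)) = 2^{[Δ_E > 0]}` — the archimedean Tamagawa number (the action of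
complex conjugation on `E[2]` is trivial iff `Δ_E > 0`).  It enters the `2`-part of the optimal modular degree `m_E` exactly like a local
(Atkin–Lehner / Tamagawa) factor and NOT like a Selmer class:

* ES-35B `LevelFloorAtTwo` (Selmer-free level floor, both signs): `2^{ω(N) − 1 + [v₂N ≥ 3]·⌈v₂N/2⌉} ∣ m_E`;
* ES-35A `RealComponentDivisibilityAtTwo` (THE CANDIDATE): `Δ_E > 0 ⟹ 2^{ω(N) + [v₂N ≥ 3]·⌈v₂N/2⌉} ∣ m_E`, i.e. `c_∞(E) · 2^{level floor} ∣ m_E`;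
* ES-35C `ALMinimalOddLevelLaw`: for odd `N`, `v₂(m_E) = ω(N) − 1` (the Atkin–Lehner minimum) forces `E` supersingular at `2`, `Δ_E < 0`,
  `N ≡ 3 (mod 8)` and `Sel₂(E) = 0` — the ALL-LEVEL form of Calegari–Emerton's prime-conductor theorem (Thm 7 + Lemma 13: `𝕋_𝔪 = ℤ₂ ⟹ ρ̄`
  supersingular at `2`, totally complex, `N ≡ 3 (mod 8)`);
* `RealBitOnSlice` = ES-35A restricted to the crux's hypotheses, with the one-line glue `realBitOnSlice_of`.

Population of every census line: optimal `E/ℚ` (minimal `deg` among parametrisations by the same newform), `ρ̄_{E,2}` SURJECTIVE (no rational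
`2`-torsion and `Δ` not a square), non-CM; `N ≤ 10⁵` = all 311 308 such curves in Cremona's table (in-sample `N ≤ 10⁴`: 24 930; out of sample
`10⁴ < N ≤ 10⁵`: 286 378).  DATA = ENGINE 35c/35d/35f (pure-integer passes, this seat) over the -es g23 tables `job32/s32_100k.json` (a-invariants,
`deg`; sha16 5e68b8e5fcc4162b) ⨝ `outputs/selmer32x_rows.jsonl.gz` (kit j334983: `dim Sel₂` by `mwrank`, `v₂ deg`, local root numbers; sha16
cb28ab9b2a7f527b).  CENSUS (CensusES35.md): ES-35B 311 308 / 311 308 (floor attained, `Δ < 0`, in every class `v₂N ≤ 7`: 1 358 / 3 292 /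
1 595 / 1 197 / 727 / 404 / 128 / 354 curves for `v₂N = 0,…,7`); **ES-35A 80 482 / 80 482 curves with `Δ_E > 0` (5 569 + 74 913), 0 exceptions
where 3 055 would be expected if the sign of `Δ` were irrelevant; the new floor is attained in every class `v₂N ≤ 6` (2 009 / 2 972 / 1 290 / 904 /
568 / 266 / 106)**; ES-35C 1 358 / 1 358 (163 of prime conductor = Calegari–Emerton's theorem; 1 195 composite, `ω(N)` up to `5`: beyond print).
In the congruence-number currency (`r_E`, -es g24 tables, 2 479 curves `N ≤ 1 498`): `Δ_E > 0 ⟹ v₂(r_E) ≥ ω(N)` 394 / 394 (implied via `m_E ∣ r_E`).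

PRINT ANCHORS.  Calegari–Emerton 2009, Thm 1 (3b): an `E` of ODD modular degree without rational `2`-torsion and without CM has prime conductor,
supersingular reduction at `2` and `E(ℝ)` CONNECTED — the `ω(N) = 1`, `v₂(m_E) = 0` shadow of ES-35A/C; their §3.2 handles the totally real `ρ̄`
GEOMETRICALLY (Merel–Agashe: `J₀(N)(ℝ)` is connected for `N` prime) because «the theory of modular deformations is not well understood when `ρ̄` is
totally real» and (p. 3) «the numerical coincidences … balancing the Selmer and dual Selmer groups in the Greenberg–Wiles product formula do not occur
in the case `p = 2`».  Dummigan 2006 §2 ASSUMES hypothesis (4) «complex conjugation non-trivial on `E[2]` (equivalently `E(ℝ)` connected)» for his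
`R = 𝕋` heuristic behind Watkins' conjecture.  ES-35A is the measured content of the excluded case: ONE extra `2`-adic unit, at every level.
MECHANISM SKETCHES (not claimed as proofs): (geometric) for optimal `E ↪ J = J₀(N)` with complement `A = ker(J ↠ E)`, the real isogeny
`E(ℝ) × A(ℝ) → J(ℝ)` has kernel `E[m_E](ℝ)` surjecting onto `ker(π₀E(ℝ) ⊕ π₀A(ℝ) → π₀J(ℝ))`; if `Δ_E > 0` and the egg component of `E(ℝ)` dies in
`π₀(J(ℝ))/π₀(A(ℝ))` then `E[m_E]` has a real point off `E⁰(ℝ)`, forcing `2 ∣ m_E` (for `N` prime `π₀ J(ℝ) = 0`: this IS Calegari–Emerton (3b));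
(deformation-theoretic) at `p = 2` the archimedean local condition `H¹(ℝ, ad⁰ρ̄)` has dimension `3` instead of `1` exactly when `c` acts trivially on
`E[2]`, an unbalanced term in the Greenberg–Wiles count.  Neither sketch explains the additive unit `⌈v/2⌉` nor why the bit sits with the level floor
and not with the Selmer floor (ES-32B♯: `v₂(m_E) ≥ dim Sel₂ + ω_odd − 1 + c(v)`, which the real bit does NOT raise: 1 117 rank-one curves with
`Δ > 0`, `2 ∤ N` sit on the ES-32 floor).  Nothing here is a theorem beyond print; BSD is not proved.
-/

open scoped Classical

noncomputable section

set_option linter.dupNamespace false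
set_option autoImplicit false

namespace Summit.BirchSwinnertonDyer.BirchSwinnertonDyer.Theorems.RankOneAtTwoRealComponent

open Literature.NumberTheory.EllipticCurves Literature.NumberTheory.EllipticCurves.ModularForms WeierstrassCurve
open Summit.BirchSwinnertonDyer.BirchSwinnertonDyer.Theorems.RankOneAtTwoTamagawaExponent (twoAdicFloorAtTwo oddPrimeCount)

/-- The contribution of an ADDITIVE prime `2` to the Selmer-free level floor, by conductor exponent `v = v₂(N)`: `0` for `v ≤ 2`, `⌈v/2⌉` for
`v ≥ 3` (ENGINE 35f: the floor `ω(N) − 1 + additiveUnitAtTwo v` is attained by optimal `S₃`-curves with `Δ < 0` in every class `v ≤ 7`;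
at `v = 8` the observed minimum is one higher, 144 curves).  Relation to ES-32's `twoAdicFloorAtTwo = (0,1,0,⌈v/2⌉…)`:
`ω(N) − 1 + additiveUnitAtTwo v = ω_odd(N) − 1 + twoAdicFloorAtTwo v + [v ≥ 2]`. -/
def additiveUnitAtTwo (v : ℕ) : ℕ := if v < 3 then 0 else (v + 1) / 2

/-- The Selmer-free `2`-adic LEVEL FLOOR exponent of the optimal modular degree at level `N`: `ω(N) − 1 + additiveUnitAtTwo (v₂ N)`
(`ω(N) − 1` = the Atkin–Lehner involutions, Calegari–Emerton 2009 §2 / Thm «composite-main»: for `E(ℚ)[2] = 0` the parametrisation factors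
through `X₀(N)/W'` with `[W : W'] ≤ 2`). -/
def levelFloorAtTwo (N : ℕ) : ℕ := N.primeFactors.card - 1 + additiveUnitAtTwo (padicValNat 2 N)

/-- **ES-35B `LevelFloorAtTwo` (support-grade conjecture; the Selmer-free companion of ES-32B♯).**  For an optimal `E/ℚ` with surjective
`ρ̄_{E,2}` and no CM: `2^{ω(N) − 1 + [v₂N ≥ 3]·⌈v₂N/2⌉} ∣ m_E`.  Census ENGINE 35f: 311 308 / 311 308 (`N ≤ 10⁵`), equality in 9 199 curves, all
with `Δ_E < 0` (by `v₂N = 0,…,8`: 1 358, 3 292, 1 595, 1 197, 727, 404, 128, 354, and 144 at one above the floor for `v = 8`).  At `v₂N ≥ 3` this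
is ONE HIGHER than the Selmer-free specialisation of ES-32B♯ (whose floor there is attained only by curves of positive rank).  Why it might fail:
the additive unit is an empirical fit (`v = 8` already sits one higher; a `v ∈ {3,…,7}` curve beyond `10⁵` one lower would refute it); the
`ω(N) − 1` part is print. [cite: CalegariEmerton2009, Thm 1 (1) and §2] [cite: Watkins2002, Conj. 4.1–4.2] -/
@[conjecture] def LevelFloorAtTwo : Prop :=
  ∀ (W : WeierstrassCurve ℚ) [W.IsElliptic] [W.IsGloballyMinimal] [NeZero (W.conductorNorm ℤ)]
    (D : ModularParametrizationData W (W.conductorNorm ℤ)),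
    (∀ (W'' : WeierstrassCurve ℚ) [W''.IsElliptic] (D'' : ModularParametrizationData W'' (W.conductorNorm ℤ)),
        D''.f = D.f → D.modularDegree ≤ D''.modularDegree) →
    ¬ W.HasCM → W.HasSurjectiveModNGaloisRep ((2 : ℕ) : ℤ) →
    2 ^ levelFloorAtTwo (W.conductorNorm ℤ) ∣ D.modularDegree

/-- **ES-35A `RealComponentDivisibilityAtTwo` — THE CANDIDATE OF THIS PASS (crux-grade conjecture, beyond print).**  For an optimal `E/ℚ` with
surjective `ρ̄_{E,2}` and no CM: if `Δ_E > 0` (two real components; complex conjugation trivial on `E[2]`) then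
`2^{ω(N) + [v₂N ≥ 3]·⌈v₂N/2⌉} ∣ m_E` — the archimedean Tamagawa number `c_∞(E) = #π₀(E(ℝ)) = 2` multiplies the level floor.
Census ENGINE 35f: **80 482 / 80 482** optimal curves with `Δ_E > 0`, `N ≤ 10⁵` (in-sample `N ≤ 10⁴`: 5 569; out of sample: 74 913); 0 exceptions
where 3 055 are expected if `sign Δ` were irrelevant (the `Δ < 0` rate of sitting on the level floor, class by class); the doubled floor is
attained in 7 227 curves (every class `v₂N ≤ 6`).  Shadow in print: `N` prime ⟹ (`Δ_E > 0 ⟹ 2 ∣ m_E`) is Calegari–Emerton 2009 Thm 1 (3b)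
(Merel–Agashe connectedness of `J₀(N)(ℝ)`); for every other level the statement exceeds the printed `2^{ω(N)−1} ∣ m_E` by one bit.
The bit does NOT add to the Selmer floor ES-32B♯ (1 117 rank-one curves with `Δ > 0`, `2 ∤ N`, `v₂(m_E) = ω(N) = dim Sel₂ + ω(N) − 1`).
Why it might fail: an optimal curve beyond `N = 10⁵` with `Δ > 0` on the undoubled level floor — most plausibly at `64 ∣ N` (`v₂N = 6`, where the
rank-0 floors of both signs coincide: 247 vs 37 curves two above ES-32) or where `π₀(J₀(N)(ℝ))` is large (many `p ≡ 1 (mod 4)` dividing `N`).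
[cite: CalegariEmerton2009, Thm 1 (3b), Thm 7, Thm 14, Lemma 15] [cite: Dummigan2006, §2 hypothesis (4)] [cite: Yazdani2011, §3.2] -/
@[conjecture] def RealComponentDivisibilityAtTwo : Prop :=
  ∀ (W : WeierstrassCurve ℚ) [W.IsElliptic] [W.IsGloballyMinimal] [NeZero (W.conductorNorm ℤ)]
    (D : ModularParametrizationData W (W.conductorNorm ℤ)),
    (∀ (W'' : WeierstrassCurve ℚ) [W''.IsElliptic] (D'' : ModularParametrizationData W'' (W.conductorNorm ℤ)),
        D''.f = D.f → D.modularDegree ≤ D''.modularDegree) →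
    ¬ W.HasCM → W.HasSurjectiveModNGaloisRep ((2 : ℕ) : ℤ) → 0 < W.Δ →
    2 ^ (levelFloorAtTwo (W.conductorNorm ℤ) + 1) ∣ D.modularDegree

/-- **ES-35C `ALMinimalOddLevelLaw` (crux-grade conjecture; Calegari–Emerton's Theorem 7 at every ODD level).**  For an optimal `E/ℚ` of odd
conductor `N` with surjective `ρ̄_{E,2}` and no CM: if the `2`-part of `m_E` is the Atkin–Lehner minimum, `v₂(m_E) = ω(N) − 1`, then
`a₂(E)` is even (supersingular reduction at `2`; for a globally minimal `W` with `2 ∤ N`, `frobeniusTrace W 2 = a₂(E)`), `Δ_E < 0`,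
`N ≡ 3 (mod 8)` and `Sel₂(E) = 0` (so `L(E,1) ≠ 0`).  Census ENGINE 35c/35d/35e: **1 358 / 1 358** (`N ≤ 10⁵`; `ω(N) = 1,…,5`: 163 / 414 / 543 /
225 / 13; `N mod 16 ∈ {3, 11}`: 683 / 675; the quadratic subfield `ℚ(√Δ_E)` of `ℚ(E[2])` has `2` inert in all 1 358: squarefree kernel of `Δ`
`≡ 5 (mod 8)`, `= −N_odd` in 881).  The 163 prime levels are Calegari–Emerton 2009 (Thm 7 + Lemma 13 + Thm 1 (2)); the 1 195 composite levels are
beyond print (their Thm 1 only says `m_E` is even there).  The `Sel₂` conjunct alone is ES-32B♯.  Why it might fail: a composite odd level beyond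
`10⁵` with `v₂(m_E) = ω(N) − 1` and `E` ordinary at `2` (the prime-level proof uses `J₀(N)` semistable and Fontaine's bound — both available at
squarefree `N`, neither at `p² ∣ N`; 411 of the 1 358 have `p² ∣ N`). [cite: CalegariEmerton2009, Thm 6, Thm 7, Lemma 13] [cite: Yazdani2011, §3.2–3.3] -/
@[conjecture] def ALMinimalOddLevelLaw : Prop :=
  ∀ (W : WeierstrassCurve ℚ) [W.IsElliptic] [W.IsGloballyMinimal] [NeZero (W.conductorNorm ℤ)]
    (D : ModularParametrizationData W (W.conductorNorm ℤ)),
    (∀ (W'' : WeierstrassCurve ℚ) [W''.IsElliptic] (D'' : ModularParametrizationData W'' (W.conductorNorm ℤ)),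
        D''.f = D.f → D.modularDegree ≤ D''.modularDegree) →
    ¬ W.HasCM → W.HasSurjectiveModNGaloisRep ((2 : ℕ) : ℤ) → ¬ 2 ∣ W.conductorNorm ℤ →
    padicValNat 2 D.modularDegree + 1 = (W.conductorNorm ℤ).primeFactors.card →
    Even (W.frobeniusTrace 2) ∧ W.Δ < 0 ∧ W.conductorNorm ℤ % 8 = 3 ∧ Nat.card (W.selmerGroup 2) = 1

/-- **ES-35A on the crux's slice** (`RankOneAtTwoBigImageOddLocal`: non-CM, surjective `2`-adic tower, odd torsion, odd Tamagawa product,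
analytic rank `1`): for such `W` with `Δ_W > 0` and an optimal parametrisation datum `D`, `2^{levelFloorAtTwo N + 1} ∣ deg D`.  On the slice this
says the «AL-minimal degree» regime of ES-32's `ALMinimalDegreeSelmerTrivialOnSlice` (`v₂ deg = ω_odd + c(v₂N)`) is EMPTY when `Δ > 0` and
`4 ∣ N` (there `ω_odd + c = levelFloorAtTwo N`), and one bit short of empty when `2 ∤ N` or `2 ∥ N`.  Census (slice ∩ `Δ > 0`, `N ≤ 10⁵`):
contained in ES-35A's 80 482 / 80 482.  A one-line consequence of `RealComponentDivisibilityAtTwo` (`realBitOnSlice_of`). -/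
def RealBitOnSlice : Prop :=
  ∀ (W : WeierstrassCurve ℚ) [W.IsElliptic] [W.IsGloballyMinimal] [NeZero (W.conductorNorm ℤ)],
    ¬ W.HasCM → (∀ n : ℕ, W.HasSurjectiveModNGaloisRep ((2 ^ n : ℕ) : ℤ)) → Odd W.torsionOrder → Odd W.tamagawaProduct →
    W.analyticRank = 1 →
    ∀ (D : ModularParametrizationData W (W.conductorNorm ℤ)),
    (∀ (W'' : WeierstrassCurve ℚ) [W''.IsElliptic] (D'' : ModularParametrizationData W'' (W.conductorNorm ℤ)),
        D''.f = D.f → D.modularDegree ≤ D''.modularDegree) →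
    0 < W.Δ → 2 ^ (levelFloorAtTwo (W.conductorNorm ℤ) + 1) ∣ D.modularDegree

/-- Glue: ES-35A implies its slice form (instantiate the `2`-adic tower at `n = 1`). -/
theorem realBitOnSlice_of (h : RealComponentDivisibilityAtTwo) : RealBitOnSlice := by
  intro W _ _ _ hCM hsurj _ _ _ D hopt hΔ
  exact h W D hopt hCM (by simpa using hsurj 1) hΔ

/-- Glue: ES-35A sharpens ES-35B on curves with `Δ > 0` (one more factor of `2`). -/
theorem levelFloor_of_realBit (W : WeierstrassCurve ℚ) [W.IsElliptic] [W.IsGloballyMinimal] [NeZero (W.conductorNorm ℤ)]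
    (D : ModularParametrizationData W (W.conductorNorm ℤ))
    (h : 2 ^ (levelFloorAtTwo (W.conductorNorm ℤ) + 1) ∣ D.modularDegree) :
    2 ^ levelFloorAtTwo (W.conductorNorm ℤ) ∣ D.modularDegree :=
  dvd_trans (pow_dvd_pow 2 (Nat.le_succ _)) h


/-- **First beyond-print rung of ES-35A** (the cheapest prover / refuter target of the line): for an optimal `E/ℚ` whose conductor has exactly
TWO prime factors (`N = p^a q^b`, `2` allowed), surjective `ρ̄_{E,2}`, no CM and `Δ_E > 0`: `4 ∣ m_E`.  Print gives `2 ∣ m_E` here (Calegari–Emerton 2009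
Thm 1 (1): one Atkin–Lehner involution acts as `+1` up to odd translation) and, at PRIME level only, the real-component bit (Thm 1 (3b) via Merel–Agashe).
Census (ENGINE 35f, `ω(N) = 2`, `Δ > 0`, all `v₂N`): contained in 80 482 / 80 482; cf. the -an g18 data law AN-35g («`ω(N) = 2` with a multiplicative
prime, odd analytic rank, `Δ > 0` ⇒ `4 ∣ deg φ`», 784 / 784), which is the odd-rank, multiplicative shadow of this rung — ES-35A holds in EVEN analytic
rank too (`Sel₂ = 0`, `Δ > 0`: 24 588 / 24 588 on the doubled floor or above), where `w_N = −1` on `E` and no quotient `X₀(N)/w_N → E` exists. -/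
def RealBitTwoPrimeFactors : Prop :=
  ∀ (W : WeierstrassCurve ℚ) [W.IsElliptic] [W.IsGloballyMinimal] [NeZero (W.conductorNorm ℤ)]
    (D : ModularParametrizationData W (W.conductorNorm ℤ)),
    (∀ (W'' : WeierstrassCurve ℚ) [W''.IsElliptic] (D'' : ModularParametrizationData W'' (W.conductorNorm ℤ)),
        D''.f = D.f → D.modularDegree ≤ D''.modularDegree) →
    ¬ W.HasCM → W.HasSurjectiveModNGaloisRep ((2 : ℕ) : ℤ) → (W.conductorNorm ℤ).primeFactors.card = 2 → 0 < W.Δ →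
    4 ∣ D.modularDegree

/-- Glue: ES-35A ⟹ its two-prime-factor rung. -/
theorem realBitTwoPrimeFactors_of (h : RealComponentDivisibilityAtTwo) : RealBitTwoPrimeFactors := by
  intro W _ _ _ D hopt hCM hsurj hω hΔ
  have h1 := h W D hopt hCM hsurj hΔ
  have hle : 2 ≤ levelFloorAtTwo (W.conductorNorm ℤ) + 1 := by
    unfold levelFloorAtTwo; rw [hω]; omega
  have h4 : (4 : ℕ) ∣ 2 ^ (levelFloorAtTwo (W.conductorNorm ℤ) + 1) := by
    have := pow_dvd_pow 2 hle
    simpa using this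
  exact dvd_trans h4 h1

/-! ### Sanity values of the floor (kernel-checked arithmetic; `11 = X₀(11)`, `37`, `4·37 = 148`, `8·11 = 88`, `2⁶·3·5 = 960`) -/

example : additiveUnitAtTwo 0 = 0 ∧ additiveUnitAtTwo 2 = 0 ∧ additiveUnitAtTwo 3 = 2 ∧ additiveUnitAtTwo 6 = 3 ∧ additiveUnitAtTwo 7 = 4 := by
  decide

/-- `ω(N) − 1 + additiveUnitAtTwo v = ω_odd(N) − 1 + twoAdicFloorAtTwo v + [v ≥ 2]` on the exponent functions (the `N`-free part). -/
theorem additiveUnit_vs_twoAdicFloor (v : ℕ) :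
    (if v = 0 then 0 else 1) + additiveUnitAtTwo v = twoAdicFloorAtTwo v + (if 2 ≤ v then 1 else 0) := by
  unfold additiveUnitAtTwo twoAdicFloorAtTwo
  rcases Nat.lt_or_ge v 3 with hv | hv
  · interval_cases v <;> simp
  · have h0 : v ≠ 0 := by omega
    have h1 : v ≠ 1 := by omega
    have h2 : v ≠ 2 := by omega
    simp [h0, h1, h2, show ¬ v < 3 by omega, show 2 ≤ v by omega]
    omega

end Summit.BirchSwinnertonDyer.BirchSwinnertonDyer.Theorems.RankOneAtTwoRealComponent
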